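import Literature.Geometry.Manifold.QuotientMaps
import Mathlib.Geometry.Manifold.Diffeomorph
import HarnessLib

/-!
# Maps between two quotient manifolds `M₁/G₁ → M₂/G₂` induced by a map `φ : M₁ → M₂` (`F ∘ π₁ = π₂ ∘ φ`) are `C^n`,
# resp. `C^n` local diffeomorphisms, resp. diffeomorphisms, when `φ` is

Topic `Literature/Geometry/Manifold`; namespace `Literature.Geometry.Manifold.QuotientManifold`. Complement to the tree's
`QuotientManifold.lean` (the `C^n` structure on `M/G` for a free properly discontinuous action by `C^n` maps; `mk` a `C^n`
local diffeomorphism) and `QuotientMaps.lean` (descent `contMDiff_comp_mk_iff`; maps of quotients `M/G₁ → M/G` OVER THE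
SAME `M` with `f ∘ mk = mk`: `contMDiff_of_comp_mk_eq`, `isLocalDiffeomorph_of_comp_mk_eq`). Here the two actions live on
two manifolds `M₁`, `M₂` (models `I₁`, `I₂`) and the induced map covers an arbitrary `C^n` map `φ : M₁ → M₂`:
`F (mk x) = mk (φ x)`. Written (lane `lit-hodgefound`, prover seat p40, generation 19, row g19-#3a) for the second Hecke
projection `π₂ [x] = [q · x]` and the translation isomorphism `Γ\D ≅ (qΓq⁻¹)\D`, `[x] ↦ [q · x]`, of a Mumford–Tate domain
(`Literature/Geometry/Kaehler/ComplexTorusHodgeDomainHeckeCorrespondences.lean`), which cover the biholomorphism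
`x ↦ q · x` of `D` rather than the identity. ONE DEFINITION WITH BODY (`diffeomorphOfQuotients`: the diffeomorphism of
quotients induced by an equivalence `e` covering `C^n` maps both ways) and theorems; no instance, no named fact.

THE PRINTED STATEMENTS.
* [Lee2012] J. M. Lee, *Introduction to Smooth Manifolds*, 2nd ed. (2012): Thm. 4.29 ("`F` is smooth if and only if
  `F ∘ π` is smooth", characteristic property of surjective smooth submersions — `mk` is a `C^n` local diffeomorphism,
  in particular a submersion), Thm. 4.30 (passing to the quotient: "a unique smooth map `F̃ : N → P` such that
  `F̃ ∘ π = F`"), Thm. 21.13 (quotients by free proper actions of discrete Lie groups).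
* [DiamondShurman2005] F. Diamond, J. Shurman, §5.1 display (5.1) and Exercise 5.1.5: "the modular curve isomorphism is
  `Γ₃τ ↦ Γ₃'α(τ)`" — the isomorphism `X₃ ≅ X₃'` induced by the automorphism `τ ↦ α(τ)` of `ℋ`.

WHAT IS FORMALISED (two free properly discontinuous `C^n` actions `G₁ ↷ M₁`, `G₂ ↷ M₂` on locally compact Hausdorff
manifolds, hypotheses `h₁`, `h₂` that each `g • ·` is `C^n`; `F : M₁/G₁ → M₂/G₂`, `φ : M₁ → M₂` with `F (mk x) = mk (φ x)`):
* **`contMDiff_of_comp_mk_eq_comp`** — `φ` `C^n` ⟹ `F` `C^n` (descent: `F ∘ mk = mk ∘ φ`);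
* **`isLocalDiffeomorph_of_comp_mk_eq_comp`** — `φ` a `C^n` local diffeomorphism ⟹ `F` a `C^n` local diffeomorphism
  (near `[x]`, `F = mk ∘ φ ∘ σ_x` for the `C^n` local section `σ_x` of `mk` through `x`; a private copy of the germ-locality
  of `IsLocalDiffeomorphAt`, whose tree instance `IsLocalDiffeomorphAt.congr_of_eventuallyEq` lives in
  `Literature/Topology/FourManifolds/ConjugationQuotientsComparison.lean`, is used to conclude);
* **`diffeomorphOfQuotients`** — an equivalence `e : M₁/G₁ ≃ M₂/G₂` covering `C^n` maps `φ` (for `e`) and `ψ` (for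
  `e.symm`) is a `C^n` diffeomorphism; `diffeomorphOfQuotients_apply`, `coe_diffeomorphOfQuotients(_symm)`.
-/

open scoped Manifold ContDiff Topology
open Set Function MulAction Filter

noncomputable section

namespace Literature.Geometry.Manifold

namespace QuotientManifold

section Congr

variable {𝕜 : Type*} [NontriviallyNormedField 𝕜] {E : Type*} [NormedAddCommGroup E] [NormedSpace 𝕜 E] {H : Type*}
  [TopologicalSpace H] {I : ModelWithCorners 𝕜 E H} {E' : Type*} [NormedAddCommGroup E'] [NormedSpace 𝕜 E']
  {H' : Type*} [TopologicalSpace H'] {J : ModelWithCorners 𝕜 E' H'} {n : ℕ∞ω}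
  {M : Type*} [TopologicalSpace M] [ChartedSpace H M] {N : Type*} [TopologicalSpace N] [ChartedSpace H' N]

/-- Germ-locality of `IsLocalDiffeomorphAt`: a map agreeing near `x` with a `C^n` local diffeomorphism at `x` is one
(private copy of the tree's `IsLocalDiffeomorphAt.congr_of_eventuallyEq` from
`Literature/Topology/FourManifolds/ConjugationQuotientsComparison.lean`, not imported here). [folklore] -/
private theorem isLocalDiffeomorphAt_congr {f g : M → N} {x : M} (hg : IsLocalDiffeomorphAt I J n g x)
    (hfg : f =ᶠ[𝓝 x] g) : IsLocalDiffeomorphAt I J n f x := by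
  obtain ⟨Φ, hx, heq⟩ := hg
  obtain ⟨U, hUsub, hUo, hxU⟩ := mem_nhds_iff.1 hfg
  refine ⟨{ toPartialEquiv := Φ.toPartialEquiv.restr U
            open_source := Φ.open_source.inter hUo
            open_target := Φ.toOpenPartialHomeomorph.continuousOn_symm.isOpen_inter_preimage Φ.open_target hUo
            contMDiffOn_toFun := Φ.contMDiffOn_toFun.mono inter_subset_left
            contMDiffOn_invFun := Φ.contMDiffOn_invFun.mono inter_subset_left }, ⟨hx, hxU⟩, fun y hy ↦ ?_⟩
  exact (hUsub hy.2).trans (heq hy.1)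

end Congr

section TwoQuotients

variable {𝕜 : Type*} [NontriviallyNormedField 𝕜] {n : ℕ∞ω}
  {E₁ : Type*} [NormedAddCommGroup E₁] [NormedSpace 𝕜 E₁] {H₁ : Type*} [TopologicalSpace H₁] {I₁ : ModelWithCorners 𝕜 E₁ H₁}
  {G₁ : Type*} [Group G₁] {M₁ : Type*} [TopologicalSpace M₁] [MulAction G₁ M₁]
  [ProperlyDiscontinuousSMul G₁ M₁] [ContinuousConstSMul G₁ M₁] [IsCancelSMul G₁ M₁] [T2Space M₁] [LocallyCompactSpace M₁]
  [ChartedSpace H₁ M₁] [IsManifold I₁ n M₁]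
  {E₂ : Type*} [NormedAddCommGroup E₂] [NormedSpace 𝕜 E₂] {H₂ : Type*} [TopologicalSpace H₂] {I₂ : ModelWithCorners 𝕜 E₂ H₂}
  {G₂ : Type*} [Group G₂] {M₂ : Type*} [TopologicalSpace M₂] [MulAction G₂ M₂]
  [ProperlyDiscontinuousSMul G₂ M₂] [ContinuousConstSMul G₂ M₂] [IsCancelSMul G₂ M₂] [T2Space M₂] [LocallyCompactSpace M₂]
  [ChartedSpace H₂ M₂] [IsManifold I₂ n M₂]

/-- **INDUCED MAPS OF QUOTIENTS ARE `C^n`**: if `F : M₁/G₁ → M₂/G₂` satisfies `F [x] = [φ x]` for a `C^n` map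
`φ : M₁ → M₂`, then `F` is `C^n` (descent along `mk`: `F ∘ mk = mk ∘ φ` is `C^n`). [cite: Lee2012, Thm. 4.29 and Thm. 4.30]
[cite: DiamondShurman2005, §5.1 display (5.1) and Exercise 5.1.5] -/
theorem contMDiff_of_comp_mk_eq_comp (h₁ : ∀ g : G₁, ContMDiff I₁ I₁ n (fun x : M₁ => g • x))
    (h₂ : ∀ g : G₂, ContMDiff I₂ I₂ n (fun x : M₂ => g • x)) {φ : M₁ → M₂} (hφ : ContMDiff I₁ I₂ n φ)
    {F : orbitRel.Quotient G₁ M₁ → orbitRel.Quotient G₂ M₂} (hF : ∀ x, F (mk (G := G₁) x) = mk (G := G₂) (φ x)) :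
    ContMDiff I₁ I₂ n F :=
  (contMDiff_comp_mk_iff (G := G₁) h₁).mp (((contMDiff_mk h₂).comp hφ).congr fun x => hF x)

/-- **INDUCED MAPS OF QUOTIENTS ARE `C^n` LOCAL DIFFEOMORPHISMS**: if `F [x] = [φ x]` for a `C^n` local diffeomorphism
`φ : M₁ → M₂`, then `F` is a `C^n` local diffeomorphism — near `[x]`, `F = mk ∘ φ ∘ σ_x` for the `C^n` local section
`σ_x` of `mk` through `x`, a composite of three `C^n` local diffeomorphisms. [cite: Lee2012, Thm. 4.29 and Thm. 21.13]
[cite: DiamondShurman2005, §5.1 display (5.1) and Exercise 5.1.5 ("the modular curve isomorphism is `Γ₃τ ↦ Γ₃'α(τ)`")] -/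
theorem isLocalDiffeomorph_of_comp_mk_eq_comp (h₁ : ∀ g : G₁, ContMDiff I₁ I₁ n (fun x : M₁ => g • x))
    (h₂ : ∀ g : G₂, ContMDiff I₂ I₂ n (fun x : M₂ => g • x)) {φ : M₁ → M₂} (hφ : IsLocalDiffeomorph I₁ I₂ n φ)
    {F : orbitRel.Quotient G₁ M₁ → orbitRel.Quotient G₂ M₂} (hF : ∀ x, F (mk (G := G₁) x) = mk (G := G₂) (φ x)) :
    IsLocalDiffeomorph I₁ I₂ n F := by
  intro y
  induction y using Quotient.inductionOn with
  | h x =>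
    have hmk : IsLocalDiffeomorphAt I₁ I₁ n (mk (G := G₁) (M := M₁)) x := isLocalDiffeomorph_mk h₁ x
    have hs : IsLocalDiffeomorphAt I₁ I₁ n hmk.localInverse (mk (G := G₁) x) := hmk.localInverse_isLocalDiffeomorphAt
    have hc : IsLocalDiffeomorphAt I₁ I₂ n (mk (G := G₂) (M := M₂) ∘ φ) (hmk.localInverse (mk (G := G₁) x)) :=
      (hφ _).comp (K := I₂) (P := orbitRel.Quotient G₂ M₂) (isLocalDiffeomorph_mk h₂ _)
    refine isLocalDiffeomorphAt_congr (hs.comp (K := I₂) (P := orbitRel.Quotient G₂ M₂) hc) ?_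
    filter_upwards [hmk.localInverse_open_source.mem_nhds hmk.localInverse_mem_source] with z hz
    simp only [comp_apply]
    rw [← hF, hmk.localInverse_right_inv hz]

/-- **AN EQUIVALENCE OF QUOTIENTS COVERING `C^n` MAPS BOTH WAYS IS A `C^n` DIFFEOMORPHISM**: for `e : M₁/G₁ ≃ M₂/G₂` with
`e [x] = [φ x]` and `e⁻¹ [y] = [ψ y]` for `C^n` maps `φ : M₁ → M₂`, `ψ : M₂ → M₁` (e.g. the translation isomorphism
`Γ\D ≅ (qΓq⁻¹)\D`, `[x] ↦ [q · x]`, covering the biholomorphism `x ↦ q · x`). [cite: Lee2012, Thm. 4.30 (uniqueness and smoothness of the induced map)]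
[cite: DiamondShurman2005, §5.1 Exercise 5.1.5] -/
def diffeomorphOfQuotients (h₁ : ∀ g : G₁, ContMDiff I₁ I₁ n (fun x : M₁ => g • x))
    (h₂ : ∀ g : G₂, ContMDiff I₂ I₂ n (fun x : M₂ => g • x)) (e : orbitRel.Quotient G₁ M₁ ≃ orbitRel.Quotient G₂ M₂)
    {φ : M₁ → M₂} (hφ : ContMDiff I₁ I₂ n φ) (he : ∀ x, e (mk (G := G₁) x) = mk (G := G₂) (φ x))
    {ψ : M₂ → M₁} (hψ : ContMDiff I₂ I₁ n ψ) (he' : ∀ y, e.symm (mk (G := G₂) y) = mk (G := G₁) (ψ y)) :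
    Diffeomorph I₁ I₂ (orbitRel.Quotient G₁ M₁) (orbitRel.Quotient G₂ M₂) n where
  toEquiv := e
  contMDiff_toFun := contMDiff_of_comp_mk_eq_comp h₁ h₂ hφ he
  contMDiff_invFun := contMDiff_of_comp_mk_eq_comp h₂ h₁ hψ he'

/-- The underlying map of `diffeomorphOfQuotients` is `e`. [cite: Lee2012, Thm. 4.30] -/
@[simp] theorem coe_diffeomorphOfQuotients (h₁ : ∀ g : G₁, ContMDiff I₁ I₁ n (fun x : M₁ => g • x))
    (h₂ : ∀ g : G₂, ContMDiff I₂ I₂ n (fun x : M₂ => g • x)) (e : orbitRel.Quotient G₁ M₁ ≃ orbitRel.Quotient G₂ M₂)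
    {φ : M₁ → M₂} (hφ : ContMDiff I₁ I₂ n φ) (he : ∀ x, e (mk (G := G₁) x) = mk (G := G₂) (φ x))
    {ψ : M₂ → M₁} (hψ : ContMDiff I₂ I₁ n ψ) (he' : ∀ y, e.symm (mk (G := G₂) y) = mk (G := G₁) (ψ y)) :
    ⇑(diffeomorphOfQuotients h₁ h₂ e hφ he hψ he') = e :=
  rfl

/-- The inverse of `diffeomorphOfQuotients` is `e.symm`. [cite: Lee2012, Thm. 4.30] -/
@[simp] theorem coe_diffeomorphOfQuotients_symm (h₁ : ∀ g : G₁, ContMDiff I₁ I₁ n (fun x : M₁ => g • x))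
    (h₂ : ∀ g : G₂, ContMDiff I₂ I₂ n (fun x : M₂ => g • x)) (e : orbitRel.Quotient G₁ M₁ ≃ orbitRel.Quotient G₂ M₂)
    {φ : M₁ → M₂} (hφ : ContMDiff I₁ I₂ n φ) (he : ∀ x, e (mk (G := G₁) x) = mk (G := G₂) (φ x))
    {ψ : M₂ → M₁} (hψ : ContMDiff I₂ I₁ n ψ) (he' : ∀ y, e.symm (mk (G := G₂) y) = mk (G := G₁) (ψ y)) :
    ⇑(diffeomorphOfQuotients h₁ h₂ e hφ he hψ he').symm = e.symm :=
  rfl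

/-- Value on classes: `diffeomorphOfQuotients … [x] = [φ x]`. [cite: Lee2012, Thm. 4.30] -/
theorem diffeomorphOfQuotients_apply_mk (h₁ : ∀ g : G₁, ContMDiff I₁ I₁ n (fun x : M₁ => g • x))
    (h₂ : ∀ g : G₂, ContMDiff I₂ I₂ n (fun x : M₂ => g • x)) (e : orbitRel.Quotient G₁ M₁ ≃ orbitRel.Quotient G₂ M₂)
    {φ : M₁ → M₂} (hφ : ContMDiff I₁ I₂ n φ) (he : ∀ x, e (mk (G := G₁) x) = mk (G := G₂) (φ x))
    {ψ : M₂ → M₁} (hψ : ContMDiff I₂ I₁ n ψ) (he' : ∀ y, e.symm (mk (G := G₂) y) = mk (G := G₁) (ψ y)) (x : M₁) :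
    diffeomorphOfQuotients h₁ h₂ e hφ he hψ he' (mk (G := G₁) x) = mk (G := G₂) (φ x) :=
  he x

/-- If moreover `φ` is a `C^n` local diffeomorphism, the induced equivalence is a local diffeomorphism (of course: it is a
diffeomorphism); recorded for maps `F` given only as functions. [cite: Lee2012, Thm. 4.29] -/
theorem isLocalDiffeomorph_equiv_of_comp_mk_eq_comp (h₁ : ∀ g : G₁, ContMDiff I₁ I₁ n (fun x : M₁ => g • x))
    (h₂ : ∀ g : G₂, ContMDiff I₂ I₂ n (fun x : M₂ => g • x)) (e : orbitRel.Quotient G₁ M₁ ≃ orbitRel.Quotient G₂ M₂)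
    {φ : M₁ → M₂} (hφ : IsLocalDiffeomorph I₁ I₂ n φ) (he : ∀ x, e (mk (G := G₁) x) = mk (G := G₂) (φ x)) :
    IsLocalDiffeomorph I₁ I₂ n e :=
  isLocalDiffeomorph_of_comp_mk_eq_comp h₁ h₂ hφ he

end TwoQuotients

end QuotientManifold

end Literature.Geometry.Manifold
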